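import Summits.NavierStokesRegularity.NavierStokesRegularity.Theorems.WakeRatchetEternalInviscidRateBlockDSSNoConveyor
import Summits.NavierStokesRegularity.NavierStokesRegularity.Theorems.WakeRatchetEternalInviscidRateBackscatterBudget
import Summits.NavierStokesRegularity.NavierStokesRegularity.Theorems.WakeRatchetEternalInviscidRateStubWakeLimit
import Summits.NavierStokesRegularity.NavierStokesRegularity.Theorems.WakeRatchetEternalInviscidRateStubTailLimit

/-!
# Conveyor ledger (crux `WakeRatchet.EternalInviscidRate`, ⟨stmt-NavierStokesRegularity-25646⟩) —
# NO PERFECT CONVEYOR: unitary block-self-similar bounded admissible inviscid eternal solutions are trivial,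
# so `stub_noConveyor` HOLDS ON THE WHOLE BLOCK-SELF-SIMILAR STRATUM (every table, every period, every `ε₀ > 0`)

The landed dichotomy `blockDSS_dichotomy` (…BlockDSSNoConveyor) left ONE case of the open stub `stub_noConveyor` on the block-self-similar
stratum undecided: the UNITARY front (`ϱ = e^{2T}Λ^{-2p} = 1`: all energy conveyed, no wake — the perfect conveyor, whose conveyor mass is
positive by `blockDSS_unitary_conveyorMass_pos`).  This file EXCLUDES it:
* `blockDSS_unitary_trivial` — a uniformly bounded admissible INVISCID eternal solution of a cancelling table (`m = 4`, `ε₀ > 0`) that is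
  block-self-similar with some shell period `p ≥ 1` and unitary block ratio is IDENTICALLY ZERO.
  PROOF (the bottom-energy leak inequality).  Unitary ⇒ wakeless, every final tail equals the conveyor mass `m > 0`, and NO tail ever
  overshoots (`unitary_tail_le_finalTail`: `T_n(σ) ≤ T_n(σ+T) ≤ … → m`).  Put `B(σ) := m − T₁(σ) ≥ E₀(σ) ≥ 0` (the energy at or below
  shell `0`; total energy is `m`).  Then `B' = −F₀` (landed `hasDerivAt_finalTail`) and `|F₀| ≤ 2C_AΛ⁻¹‖W₁‖E₀ ≤ a·B` with
  `a := 2C_AΛ⁻¹‖W₁(σ)‖` (landed `abs_physFlux_le`), whose integral over `ℝ` is at most `2C_AΛ⁻¹·M` by the ACTION clause of `IsEternal`.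
  Hence `σ ↦ B(σ)·exp(∫_{σ₀}^{σ} a)` is non-decreasing and `B(σ) ≥ B(σ₀)·e^{−2C_AΛ⁻¹M}` for `σ ≥ σ₀`: the energy at or below a shell can lose
  at most the fraction `1 − e^{−cM}` of itself through the bond above it, EVER.  But `B(σ₀) > 0` for `σ₀ → −∞` (`T₁ → 0`) while
  `B(σ) → m − m = 0` as `σ → +∞` — contradiction.  (Finite action forbids a 100 % transfer: every front leaves a wake.)
* `blockDSS_ratio_lt_one` — hence every NON-TRIVIAL such solution is STRICTLY sub-unitary, `ϱ < 1` (the landed `blockRatio_le_one` gave `≤`).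
* `blockDSS_noConveyor_all` — and the inner conclusion of `NoConveyor` («every final tail is the sum of the final wakes above it») holds for
  EVERY uniformly bounded admissible inviscid block-self-similar eternal solution of every cancelling table, any period, any `ε₀ > 0`, with no
  hypothesis on the ratio: `stub_noConveyor` is SETTLED on the block-self-similar stratum (the residual of the stub is the non-self-similar case).
* `dssWave_dssMu_lt_one` / `dssWave_noConveyor_all` — the same for admissible DSS waves `IsDSSWave ε₀ α π T Φ` (any shape permutation):
  `dssMu ε₀ T < 1` strictly for a non-zero profile, and no conveyor mass (generalising the dyadic-member `WakeRatchetDyadicWaveStrict.dssMu_lt_one`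
  to all cancelling tables and all periods).
MODEL lattice only (Tao 2016 §4 renormalised cascade); nothing here is a statement about the Navier–Stokes equations, no stub is closed by name
(the stub quantifies over ALL bounded admissible inviscid eternal solutions, not only block-self-similar ones), no summit is proved by this file.
[cite: Tao2016AveragedNS, §4 Lemma 4.1 (4.8)–(4.10) with the cancellation (4.3), in the self-similar variables of §6.4]
-/

noncomputable section

set_option linter.dupNamespace false

open Filter Topology Set MeasureTheory
open Literature.Analysis.FluidPDE Literature.Analysis.FluidPDE.TaoCascade
open Summit.NavierStokesRegularity.NavierStokesRegularity.Theorems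

namespace Summit.NavierStokesRegularity.NavierStokesRegularity.Cruxes.EternalInviscidRate.FinalWakeLedger

variable {ε₀ : ℝ}

/-! ## No overshoot under unitarity -/

/-- **Unitary fronts never overshoot their final tails:** for a uniformly bounded block-self-similar field with unitary block ratio,
`T_n(σ) ≤ L n` for every shell and every log-time (`T_n(σ) ≤ T_n(σ + T) ≤ … → L n`, `T > 0`). -/
theorem unitary_tail_le_finalTail {m : ℕ} {W : ℤ → ℝ → Em m} (hε : 0 < ε₀) (hU : UniformBound W)
    {p : ℕ} (hp : 0 < p) {T : ℝ} (hD : ∀ (n : ℤ) (σ : ℝ), W (n + p) σ = W n (σ - T))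
    (hϱ : Real.exp (2 * T) * (bigLam ε₀ ^ p)⁻¹ ^ 2 = 1)
    {L : ℤ → ℝ} (hL : ∀ n : ℤ, Tendsto (fun σ => ∑' k : ℕ, physEnergy ε₀ W (n + k) σ) atTop (𝓝 (L n)))
    (n : ℤ) (σ : ℝ) : ∑' k : ℕ, physEnergy ε₀ W (n + k) σ ≤ L n := by
  have hΛ1 : 1 < bigLam ε₀ := EternalViscousRate.DissipationEdge.one_lt_bigLam hε
  -- `T > 0`: `e^{2T} = Λ^{2p} > 1`
  have hT : 0 < T := by
    have hpow : 1 < (bigLam ε₀ ^ p) ^ 2 := by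
      have h1 : 1 < bigLam ε₀ ^ p := one_lt_pow₀ hΛ1 hp.ne'
      nlinarith
    have hexp : Real.exp (2 * T) = (bigLam ε₀ ^ p) ^ 2 := by
      have hne' : (bigLam ε₀ ^ p)⁻¹ ^ 2 ≠ 0 := by positivity
      have := hϱ
      rw [inv_pow] at this
      field_simp at this
      linarith
    have h1 : 1 < Real.exp (2 * T) := by rw [hexp]; exact hpow
    have h2 := Real.one_lt_exp_iff.mp h1
    linarith
  -- one block step along the orbit
  have hstep : ∀ σ : ℝ, ∑' k : ℕ, physEnergy ε₀ W (n + k) σ ≤ ∑' k : ℕ, physEnergy ε₀ W (n + k) (σ + T) := by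
    intro σ
    have h := WakeRatchetDSS.tail_shift hε hD n (σ + T)
    rw [hϱ, one_mul, add_sub_cancel_right] at h
    rw [← h]
    exact WakeRatchetDSS.tail_add_le_tail hε hU n p (σ + T)
  have hiter : ∀ (j : ℕ) (σ : ℝ), ∑' k : ℕ, physEnergy ε₀ W (n + k) σ
      ≤ ∑' k : ℕ, physEnergy ε₀ W (n + k) (σ + j * T) := by
    intro j
    induction j with
    | zero => intro σ; simp
    | succ j ih =>
      intro σ
      have h := hstep (σ + j * T)
      have e : σ + j * T + T = σ + ((j + 1 : ℕ) : ℝ) * T := by push_cast; ring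
      rw [e] at h
      exact (ih σ).trans h
  have hj : Tendsto (fun j : ℕ => σ + (j : ℝ) * T) atTop atTop :=
    tendsto_atTop_add_const_left _ _ (tendsto_natCast_atTop_atTop.atTop_mul_const hT)
  exact ge_of_tendsto' ((hL n).comp hj) fun j => hiter j σ

/-! ## No perfect conveyor -/

/-- **Unitary block-self-similar bounded admissible inviscid eternal solutions are trivial.**  On a cancelling table (`m = 4`, `ε₀ > 0`),
a uniformly bounded admissible inviscid eternal solution with `W_{n+p}(σ) = W_n(σ − T)` (`p ≥ 1`) and `e^{2T}Λ^{-2p} = 1` vanishes identically: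
the bottom energy `B = m − T₁ ≥ E₀` obeys `B' = −F₀ ≥ −2C_AΛ⁻¹‖W₁‖·B` with `∫‖W₁‖ < ∞` (action), so it keeps the fraction `e^{−2C_AΛ⁻¹M}` of
itself forever, against `B → 0`.  MODEL lattice only.
[cite: Tao2016AveragedNS, §4 Lemma 4.1 (4.8)–(4.10) with the cancellation (4.3), in the self-similar variables of §6.4] -/
theorem blockDSS_unitary_trivial (hε : 0 < ε₀) {α : Fin 4 → Fin 4 → Fin 4 → ℤ × ℤ × ℤ → ℝ} (hc : IsCancellingCoeff α)
    {W : ℤ → ℝ → Em 4} (hW : IsEternal ε₀ α W) (hU : UniformBound W) {p : ℕ} (hp : 0 < p) {T : ℝ}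
    (hD : ∀ (n : ℤ) (σ : ℝ), W (n + p) σ = W n (σ - T)) (hϱ : Real.exp (2 * T) * (bigLam ε₀ ^ p)⁻¹ ^ 2 = 1) :
    ∀ (n : ℤ) (σ : ℝ), W n σ = 0 := by
  by_contra hne
  push Not at hne
  obtain ⟨n₀, σ₁, hne⟩ := hne
  -- final wakes and final tails (landed stubs)
  choose ω hω using stub_wakeLimit ε₀ hε α hc W hW
  choose L hL using stub_tailLimit ε₀ hε α hc W hW hU
  have hS : ∀ (n : ℤ) (σ : ℝ), Summable (fun k : ℕ => physEnergy ε₀ W (n + k) σ) :=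
    summable_physEnergy_tail_cm hε hU
  -- unitary ⇒ wakeless, positive conveyor mass, constant final tails
  have hω0 : ∀ k : ℤ, ω k = 0 := blockDSS_unitary_wakeless hε hp hD hϱ hS hω hL
  have hm1 : 0 < conveyorMass ω L 1 := blockDSS_unitary_conveyorMass_pos hε hU hp hD hϱ hω hL hne 1
  have hL1pos : 0 < L 1 := by
    have h := hm1
    unfold conveyorMass at h
    simpa [hω0] using h
  have hL10 : L 1 = L 0 := by
    have h := blockDSS_unitary_finalTail_const hε hp hD hϱ hS hω hL 0
    rwa [zero_add] at h
  -- the tail above shell `1` and the bottom energy `B = L 1 − T₁`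
  set T1 : ℝ → ℝ := fun σ => ∑' k : ℕ, physEnergy ε₀ W (1 + k) σ with hT1
  set B : ℝ → ℝ := fun σ => L 1 - T1 σ with hB
  -- `E₀ ≤ B` (no overshoot at shell `0`)
  have hE0le : ∀ σ : ℝ, physEnergy ε₀ W 0 σ ≤ B σ := by
    intro σ
    have hsplit : ∑' k : ℕ, physEnergy ε₀ W (0 + k) σ = physEnergy ε₀ W 0 σ + T1 σ := by
      have h := (hS 0 σ).sum_add_tsum_nat_add 1
      have e : (fun k : ℕ => physEnergy ε₀ W (0 + ((k + 1 : ℕ) : ℤ)) σ) = fun k : ℕ => physEnergy ε₀ W (1 + k) σ := by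
        funext k; push_cast; ring_nf
      rw [e, Finset.sum_range_one] at h
      simpa using h.symm
    have hle : ∑' k : ℕ, physEnergy ε₀ W (0 + k) σ ≤ L 0 := unitary_tail_le_finalTail hε hU hp hD hϱ hL 0 σ
    simp only [hB, hL10]
    linarith
  have hB0 : ∀ σ : ℝ, 0 ≤ B σ := fun σ => (physEnergy_nonneg _ _ _ _).trans (hE0le σ)
  -- `B' = −F₀`
  have hBd : ∀ σ : ℝ, HasDerivAt B (-physFlux ε₀ α W 0 σ) σ := by
    intro σ
    have h := hasDerivAt_finalTail hε hc hW hU 1 σ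
    rw [sub_self] at h
    exact h.const_sub (L 1)
  -- the leak rate `a = 2C_AΛ⁻¹‖W₁‖`: `|F₀| ≤ a·E₀ ≤ a·B`
  have hΛ : 0 < bigLam ε₀ := bigLam_pos (by linarith)
  set c : ℝ := 2 * fluxConst α * (bigLam ε₀)⁻¹ with hc_def
  have hc0 : 0 ≤ c := by have := fluxConst_nonneg α; rw [hc_def]; positivity
  set a : ℝ → ℝ := fun σ => c * ‖W 1 σ‖ with ha
  have ha0 : ∀ σ : ℝ, 0 ≤ a σ := fun σ => mul_nonneg hc0 (norm_nonneg _)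
  have hFle : ∀ σ : ℝ, |physFlux ε₀ α W 0 σ| ≤ a σ * B σ := by
    intro σ
    have h := abs_physFlux_le hε hc W 0 σ
    rw [zero_add] at h
    calc |physFlux ε₀ α W 0 σ| ≤ 2 * fluxConst α * (bigLam ε₀)⁻¹ * ‖W 1 σ‖ * physEnergy ε₀ W 0 σ := h
      _ = a σ * physEnergy ε₀ W 0 σ := by rw [ha]
      _ ≤ a σ * B σ := mul_le_mul_of_nonneg_left (hE0le σ) (ha0 σ)
  -- `a` is continuous and integrable with `∫ a ≤ c·M` (action clause)
  obtain ⟨M, hM⟩ := hW.action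
  have hcontW : Continuous (fun σ : ℝ => ‖W 1 σ‖) :=
    (continuous_iff_continuousAt.2 fun σ => (hW.law 1 σ).continuousAt).norm
  have hcont_a : Continuous a := continuous_const.mul hcontW
  have hint_a : Integrable a := ((hM 1).1).const_mul c
  -- a starting log-time with `B σ₀ > 0` (`T₁ → 0` in the far past)
  obtain ⟨σ₀, hσ₀⟩ : ∃ σ₀ : ℝ, T1 σ₀ < L 1 / 2 :=
    ((tendsto_order.1 (tendsto_finalTail_atBot hε hU 1)).2 (L 1 / 2) (half_pos hL1pos)).exists
  have hBσ₀ : 0 < B σ₀ := by simp only [hB]; linarith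
  -- the integrating factor `exp(∫_{σ₀}^{σ} a)`
  set I : ℝ → ℝ := fun σ => ∫ s in σ₀..σ, a s with hI
  have hId : ∀ σ : ℝ, HasDerivAt I (a σ) σ := fun σ => (hcont_a.integral_hasStrictDerivAt σ₀ σ).hasDerivAt
  set G : ℝ → ℝ := fun σ => B σ * Real.exp (I σ) with hG
  have hGd : ∀ σ : ℝ, HasDerivAt G (-physFlux ε₀ α W 0 σ * Real.exp (I σ) + B σ * (Real.exp (I σ) * a σ)) σ :=
    fun σ => (hBd σ).mul (hId σ).exp
  have hG' : ∀ σ : ℝ, 0 ≤ deriv G σ := by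
    intro σ
    rw [(hGd σ).deriv]
    have hexp : 0 < Real.exp (I σ) := Real.exp_pos _
    have h1 : -(a σ * B σ) ≤ -physFlux ε₀ α W 0 σ := by
      have := le_abs_self (physFlux ε₀ α W 0 σ)
      linarith [hFle σ]
    have h2 : 0 ≤ (-physFlux ε₀ α W 0 σ + a σ * B σ) * Real.exp (I σ) := mul_nonneg (by linarith) hexp.le
    have e : -physFlux ε₀ α W 0 σ * Real.exp (I σ) + B σ * (Real.exp (I σ) * a σ)
        = (-physFlux ε₀ α W 0 σ + a σ * B σ) * Real.exp (I σ) := by ring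
    rw [e]; exact h2
  have hGmono : Monotone G := monotone_of_deriv_nonneg (fun σ => (hGd σ).differentiableAt) hG'
  -- `∫_{σ₀}^{σ} a ≤ c·M`
  have hIle : ∀ σ : ℝ, σ₀ ≤ σ → I σ ≤ c * M := by
    intro σ hσ
    simp only [hI]
    rw [intervalIntegral.integral_of_le hσ]
    calc ∫ s in Ioc σ₀ σ, a s ≤ ∫ s, a s := setIntegral_le_integral hint_a (Eventually.of_forall ha0)
      _ = c * ∫ s, ‖W 1 s‖ := integral_const_mul _ _
      _ ≤ c * M := mul_le_mul_of_nonneg_left (hM 1).2 hc0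
  -- the leak inequality: `B σ₀ ≤ B σ · e^{cM}` for `σ ≥ σ₀`
  have hkey : ∀ σ : ℝ, σ₀ ≤ σ → B σ₀ ≤ B σ * Real.exp (c * M) := by
    intro σ hσ
    have h1 : G σ₀ ≤ G σ := hGmono hσ
    have hG0 : G σ₀ = B σ₀ := by simp [hG, hI, intervalIntegral.integral_same]
    have h2 : B σ * Real.exp (I σ) ≤ B σ * Real.exp (c * M) :=
      mul_le_mul_of_nonneg_left (Real.exp_le_exp.2 (hIle σ hσ)) (hB0 σ)
    have h3 : G σ = B σ * Real.exp (I σ) := rfl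
    linarith
  -- but `B → 0`
  have hBlim : Tendsto (fun σ => B σ * Real.exp (c * M)) atTop (𝓝 ((L 1 - L 1) * Real.exp (c * M))) :=
    (tendsto_const_nhds.sub (hL 1)).mul_const _
  have hle : B σ₀ ≤ (L 1 - L 1) * Real.exp (c * M) :=
    ge_of_tendsto hBlim ((eventually_ge_atTop σ₀).mono fun σ hσ => hkey σ hσ)
  rw [sub_self, zero_mul] at hle
  exact absurd hle (not_le.2 hBσ₀)

/-- **Strict sub-unitarity.**  Every NON-TRIVIAL uniformly bounded admissible inviscid block-self-similar eternal solution of a cancelling table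
has block ratio `e^{2T}Λ^{-2p} < 1` strictly (the landed `blockRatio_le_one` gives `≤ 1`; equality is the excluded perfect conveyor). -/
theorem blockDSS_ratio_lt_one (hε : 0 < ε₀) {α : Fin 4 → Fin 4 → Fin 4 → ℤ × ℤ × ℤ → ℝ} (hc : IsCancellingCoeff α)
    {W : ℤ → ℝ → Em 4} (hW : IsEternal ε₀ α W) (hU : UniformBound W) {p : ℕ} (hp : 0 < p) {T : ℝ}
    (hD : ∀ (n : ℤ) (σ : ℝ), W (n + p) σ = W n (σ - T)) {n₀ : ℤ} {σ₀ : ℝ} (hne : W n₀ σ₀ ≠ 0) :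
    Real.exp (2 * T) * (bigLam ε₀ ^ p)⁻¹ ^ 2 < 1 := by
  have hle := WakeRatchetDSS.blockRatio_le_one hε hc hW.isEternalVisc hU hD hne
  rcases hle.lt_or_eq with hlt | heq
  · exact hlt
  · exact absurd (blockDSS_unitary_trivial hε hc hW hU hp hD heq n₀ σ₀) hne

/-- **`stub_noConveyor` on the whole block-self-similar stratum.**  For EVERY uniformly bounded admissible inviscid eternal solution of a
cancelling table (`m = 4`, any `ε₀ > 0`) that is block-self-similar with some period `p ≥ 1` and some lag, every final tail equals the sum of
the final wakes above it — the inner conclusion of `NoConveyor`, with no hypothesis on the block ratio. -/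
theorem blockDSS_noConveyor_all (hε : 0 < ε₀) {α : Fin 4 → Fin 4 → Fin 4 → ℤ × ℤ × ℤ → ℝ} (hc : IsCancellingCoeff α)
    {W : ℤ → ℝ → Em 4} (hW : IsEternal ε₀ α W) (hU : UniformBound W) {p : ℕ} (hp : 0 < p) {T : ℝ}
    (hD : ∀ (n : ℤ) (σ : ℝ), W (n + p) σ = W n (σ - T))
    {ω : ℤ → ℝ} (hω : ∀ k : ℤ, Tendsto (physEnergy ε₀ W k) atTop (𝓝 (ω k)))
    {L : ℤ → ℝ} (hL : ∀ n : ℤ, Tendsto (fun σ => ∑' k : ℕ, physEnergy ε₀ W (n + k) σ) atTop (𝓝 (L n)))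
    (n : ℤ) : L n = ∑' k : ℕ, ω (n + k) := by
  have hS : ∀ (n : ℤ) (σ : ℝ), Summable (fun k : ℕ => physEnergy ε₀ W (n + k) σ) :=
    summable_physEnergy_tail_cm hε hU
  by_cases hz : ∀ (n : ℤ) (σ : ℝ), W n σ = 0
  · -- the zero field: tails and wakes vanish
    have hE : ∀ (k : ℤ) (σ : ℝ), physEnergy ε₀ W k σ = 0 := by
      intro k σ; unfold physEnergy; rw [hz k σ, norm_zero]; ring
    have hω0 : ∀ k : ℤ, ω k = 0 := by
      intro k
      have h0 : Tendsto (physEnergy ε₀ W k) atTop (𝓝 0) := by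
        have e : physEnergy ε₀ W k = fun _ => 0 := funext fun σ => hE k σ
        rw [e]; exact tendsto_const_nhds
      exact tendsto_nhds_unique (hω k) h0
    have hLn : L n = 0 := by
      have h0 : Tendsto (fun σ => ∑' k : ℕ, physEnergy ε₀ W (n + k) σ) atTop (𝓝 0) := by
        have e : (fun σ => ∑' k : ℕ, physEnergy ε₀ W (n + k) σ) = fun _ => 0 := by
          funext σ; simp [hE]
        rw [e]; exact tendsto_const_nhds
      exact tendsto_nhds_unique (hL n) h0
    rw [hLn]; simp [hω0]
  · push Not at hz
    obtain ⟨n₀, σ₀, hne⟩ := hz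
    exact blockDSS_noConveyor hε hp hD (blockDSS_ratio_lt_one hε hc hW hU hp hD hne) hS hω hL n

/-! ## DSS waves -/

/-- **Every non-trivial admissible DSS wave is STRICTLY sub-unitary:** for a cancelling table (`m = 4`, `ε₀ > 0`) and an admissible DSS wave
`IsDSSWave ε₀ α π T Φ` (any period, any shape permutation) with a non-zero profile value, `dssMu ε₀ T < 1` — every exact self-similar front
leaves a wake.  (The landed `IsDSSWave.dssMu_le_one` gave `≤ 1`; the dyadic member's `WakeRatchetDyadicWaveStrict.dssMu_lt_one` is the
period-one scalar case.) -/
theorem dssWave_dssMu_lt_one {ρ : Type*} [Fintype ρ] {α : Fin 4 → Fin 4 → Fin 4 → ℤ × ℤ × ℤ → ℝ}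
    {π : Equiv.Perm ρ} {T : ℝ} {Φ : ρ → ℝ → Em 4} (hε : 0 < ε₀) (hc : IsCancellingCoeff α)
    (h : IsDSSWave ε₀ α π T Φ) {r : ρ} {x : ℝ} (hne : Φ r x ≠ 0) : dssMu ε₀ T < 1 := by
  have hp : 0 < orderOf π := orderOf_pos π
  have hW : IsEternal ε₀ α (dssEmbed π T Φ r) := h.isEternal_dssEmbed r
  have hU : UniformBound (dssEmbed π T Φ r) := uniformBound_dssEmbed h r
  have hne' : dssEmbed π T Φ r 0 x ≠ 0 := by simpa [dssEmbed] using hne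
  have hlt := blockDSS_ratio_lt_one hε hc hW hU hp (T := orderOf π * T)
    (WakeRatchetDSS.dssEmbed_shift π T Φ r) hne'
  rw [WakeRatchetDSS.blockRatio_orderOf_eq_pow hε.le] at hlt
  exact (pow_lt_one_iff_of_nonneg (dssMu_pos T (by linarith)).le hp.ne').1 hlt

/-- **Admissible DSS waves have no conveyor mass** (`stub_noConveyor` on the DSS stratum, unconditionally): for a cancelling table and an
admissible DSS wave (any period, any shape permutation), the eternal solution `dssEmbed π T Φ r` it carries has every final tail equal to
the sum of the final wakes above it. -/
theorem dssWave_noConveyor_all {ρ : Type*} [Fintype ρ] {α : Fin 4 → Fin 4 → Fin 4 → ℤ × ℤ × ℤ → ℝ}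
    {π : Equiv.Perm ρ} {T : ℝ} {Φ : ρ → ℝ → Em 4} (hε : 0 < ε₀) (hc : IsCancellingCoeff α)
    (h : IsDSSWave ε₀ α π T Φ) (r : ρ)
    {ω : ℤ → ℝ} (hω : ∀ k : ℤ, Tendsto (physEnergy ε₀ (dssEmbed π T Φ r) k) atTop (𝓝 (ω k)))
    {L : ℤ → ℝ}
    (hL : ∀ n : ℤ, Tendsto (fun σ => ∑' k : ℕ, physEnergy ε₀ (dssEmbed π T Φ r) (n + k) σ) atTop (𝓝 (L n)))
    (n : ℤ) : L n = ∑' k : ℕ, ω (n + k) :=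
  blockDSS_noConveyor_all hε hc (h.isEternal_dssEmbed r) (uniformBound_dssEmbed h r) (orderOf_pos π)
    (WakeRatchetDSS.dssEmbed_shift π T Φ r) hω hL n

end Summit.NavierStokesRegularity.NavierStokesRegularity.Cruxes.EternalInviscidRate.FinalWakeLedger

end
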